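import Literature.AlgebraicGeometry.Shioda1982.ExceptionalQuadruplesComplete
import HarnessLib

/-!
# Shioda 1982 / Meyer–Neutsch 1981: no exceptional quadruple at the levels `122 ≤ N ≤ 128` absent from Tabelle 1 (kernel sweep)

Topic `Literature/AlgebraicGeometry/Shioda1982`; companion of `ExceptionalQuadruplesComplete.lean` (search `checkB`, soundness
`tabelleOneCompleteAt_of_chunks`, invariant form `exists_mem_reps_of_isExceptionalQuadruple`, statement `TabelleOneCompleteAt`; sources,
method and framing in its module docstring), of the sweeps `ExceptionalQuadruplesSweepSixty/…/Ninety.lean` (all `2 ≤ N ≤ 90`),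
`…SweepOneHundredTwelve.lean` (`N = 112`), `…SweepOneHundredThirtyTwo.lean` (`N = 132`) and of the other files of this series
(`ExceptionalQuadruplesSweep<lo>To<hi>.lean`, together: every level `91 ≤ N ≤ 179` that is not a row of Tabelle 1). THEOREMS only (no
definition, no named fact): the kernel search at each level `N` of this file's range that carries NO row of
[MeyerNeutsch1981Fermatquadrupel, Tabelle 1] (computer-generated there, "alle Fermatquadrupel für N ≤ 614 ermittelt", §2 p. 53; zeros of
[Shioda1982PicardFermat, table p. 727], whose non-zero entries `N ≤ 180` are exactly the 22 table levels): `completeAt_<N>` (every sorted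
pair-free primitive Hodge 4-multiset mod `N` is standard) and `not_isExceptionalQuadruple_<N>`. With the table levels
(`ExceptionalQuadruplesComplete*.lean`: the printed list is complete at each of its 22 levels `≤ 180`) the series makes Meyer–Neutsch's
classification of the exceptional surface classes kernel-certified at EVERY level `N ≤ 180`; above `180` there are none by Aoki's
Theorem C ([Aoki1983], computer-assisted for `181 ≤ m ≤ 672`, not a kernel statement). `decide +kernel` only (no `native_decide`),
chunked by first entries to bound the memory of a single kernel evaluation (≈ 0.9 ms of kernel time per candidate triple; this file
visits 393814 candidates).

HONEST FRAMING (cell `pub-hfermat`): explicit algebraic cycles for specific Hodge classes on Fermat/Delsarte varieties; residual open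
instances listed; no claim on general Hodge. These classes are algebraic (Lefschetz (1,1)); certified here is only the emptiness of the
exceptional list at these levels.

## References
* [MeyerNeutsch1981Fermatquadrupel] W. Meyer, W. Neutsch, *Fermatquadrupel*, Math. Ann. 256 (1981) 51–62, §2 p. 53, Tabelle 1 p. 54 (no rows 122, 123, 124, 125, 126, 127, 128).
* [Shioda1982PicardFermat] T. Shioda, J. Fac. Sci. Univ. Tokyo IA 28 (1982) 725–734, table p. 727.
* [Aoki1983] N. Aoki, Math. Ann. 266 (1983) 23–54, Thm. C.
-/

namespace Literature.AlgebraicGeometry.Shioda1982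

open Literature.AlgebraicGeometry.HodgeTheory

set_option maxHeartbeats 0 in
/-- **Tabelle 1 is complete at `N = 122`, where it is empty**: every sorted Hodge 4-multiset mod `122` without a pair and with
`gcd = 1` is standard. Kernel exhaustion (`checkB`, 3 chunks of first entries, 52311 candidate triples).
[cite: MeyerNeutsch1981Fermatquadrupel, §2 p. 53 ("alle Fermatquadrupel für N ≤ 614 ermittelt") and Tabelle 1 p. 54 (no row 122)]
[cite: Shioda1982PicardFermat, table p. 727] -/
theorem completeAt_oneHundredTwentyTwo : TabelleOneCompleteAt 122 :=
  tabelleOneCompleteAt_of_chunks 122 [(0, 18), (18, 24), (42, 80)] (by decide +kernel) (by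
    intro p hp
    simp only [List.mem_cons, List.not_mem_nil, or_false] at hp
    rcases hp with rfl | rfl | rfl <;> decide +kernel)

set_option maxHeartbeats 0 in
/-- **Tabelle 1 is complete at `N = 123`, where it is empty**: every sorted Hodge 4-multiset mod `123` without a pair and with
`gcd = 1` is standard. Kernel exhaustion (`checkB`, 3 chunks of first entries, 53592 candidate triples).
[cite: MeyerNeutsch1981Fermatquadrupel, §2 p. 53 ("alle Fermatquadrupel für N ≤ 614 ermittelt") and Tabelle 1 p. 54 (no row 123)]
[cite: Shioda1982PicardFermat, table p. 727] -/
theorem completeAt_oneHundredTwentyThree : TabelleOneCompleteAt 123 :=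
  tabelleOneCompleteAt_of_chunks 123 [(0, 18), (18, 23), (41, 82)] (by decide +kernel) (by
    intro p hp
    simp only [List.mem_cons, List.not_mem_nil, or_false] at hp
    rcases hp with rfl | rfl | rfl <;> decide +kernel)

set_option maxHeartbeats 0 in
/-- **Tabelle 1 is complete at `N = 124`, where it is empty**: every sorted Hodge 4-multiset mod `124` without a pair and with
`gcd = 1` is standard. Kernel exhaustion (`checkB`, 3 chunks of first entries, 54894 candidate triples).
[cite: MeyerNeutsch1981Fermatquadrupel, §2 p. 53 ("alle Fermatquadrupel für N ≤ 614 ermittelt") and Tabelle 1 p. 54 (no row 124)]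
[cite: Shioda1982PicardFermat, table p. 727] -/
theorem completeAt_oneHundredTwentyFour : TabelleOneCompleteAt 124 :=
  tabelleOneCompleteAt_of_chunks 124 [(0, 18), (18, 22), (40, 84)] (by decide +kernel) (by
    intro p hp
    simp only [List.mem_cons, List.not_mem_nil, or_false] at hp
    rcases hp with rfl | rfl | rfl <;> decide +kernel)

set_option maxHeartbeats 0 in
/-- **Tabelle 1 is complete at `N = 125`, where it is empty**: every sorted Hodge 4-multiset mod `125` without a pair and with
`gcd = 1` is standard. Kernel exhaustion (`checkB`, 3 chunks of first entries, 56217 candidate triples).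
[cite: MeyerNeutsch1981Fermatquadrupel, §2 p. 53 ("alle Fermatquadrupel für N ≤ 614 ermittelt") and Tabelle 1 p. 54 (no row 125)]
[cite: Shioda1982PicardFermat, table p. 727] -/
theorem completeAt_oneHundredTwentyFive : TabelleOneCompleteAt 125 :=
  tabelleOneCompleteAt_of_chunks 125 [(0, 17), (17, 21), (38, 87)] (by decide +kernel) (by
    intro p hp
    simp only [List.mem_cons, List.not_mem_nil, or_false] at hp
    rcases hp with rfl | rfl | rfl <;> decide +kernel)

set_option maxHeartbeats 0 in
/-- **Tabelle 1 is complete at `N = 126`, where it is empty**: every sorted Hodge 4-multiset mod `126` without a pair and with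
`gcd = 1` is standard. Kernel exhaustion (`checkB`, 3 chunks of first entries, 57561 candidate triples).
[cite: MeyerNeutsch1981Fermatquadrupel, §2 p. 53 ("alle Fermatquadrupel für N ≤ 614 ermittelt") and Tabelle 1 p. 54 (no row 126)]
[cite: Shioda1982PicardFermat, table p. 727] -/
theorem completeAt_oneHundredTwentySix : TabelleOneCompleteAt 126 :=
  tabelleOneCompleteAt_of_chunks 126 [(0, 17), (17, 20), (37, 89)] (by decide +kernel) (by
    intro p hp
    simp only [List.mem_cons, List.not_mem_nil, or_false] at hp
    rcases hp with rfl | rfl | rfl <;> decide +kernel)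

set_option maxHeartbeats 0 in
/-- **Tabelle 1 is complete at `N = 127`, where it is empty**: every sorted Hodge 4-multiset mod `127` without a pair and with
`gcd = 1` is standard. Kernel exhaustion (`checkB`, 3 chunks of first entries, 58926 candidate triples).
[cite: MeyerNeutsch1981Fermatquadrupel, §2 p. 53 ("alle Fermatquadrupel für N ≤ 614 ermittelt") and Tabelle 1 p. 54 (no row 127)]
[cite: Shioda1982PicardFermat, table p. 727] -/
theorem completeAt_oneHundredTwentySeven : TabelleOneCompleteAt 127 :=
  tabelleOneCompleteAt_of_chunks 127 [(0, 17), (17, 19), (36, 91)] (by decide +kernel) (by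
    intro p hp
    simp only [List.mem_cons, List.not_mem_nil, or_false] at hp
    rcases hp with rfl | rfl | rfl <;> decide +kernel)

set_option maxHeartbeats 0 in
/-- **Tabelle 1 is complete at `N = 128`, where it is empty**: every sorted Hodge 4-multiset mod `128` without a pair and with
`gcd = 1` is standard. Kernel exhaustion (`checkB`, 3 chunks of first entries, 60313 candidate triples).
[cite: MeyerNeutsch1981Fermatquadrupel, §2 p. 53 ("alle Fermatquadrupel für N ≤ 614 ermittelt") and Tabelle 1 p. 54 (no row 128)]
[cite: Shioda1982PicardFermat, table p. 727] -/
theorem completeAt_oneHundredTwentyEight : TabelleOneCompleteAt 128 :=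
  tabelleOneCompleteAt_of_chunks 128 [(0, 17), (17, 19), (36, 92)] (by decide +kernel) (by
    intro p hp
    simp only [List.mem_cons, List.not_mem_nil, or_false] at hp
    rcases hp with rfl | rfl | rfl <;> decide +kernel)

/-- **No exceptional quadruple ("Ausnahmequadrupel") at the level `122`** (`tabelleOne 122 = []`).
[cite: MeyerNeutsch1981Fermatquadrupel, Tabelle 1 p. 54 (no row 122)] [cite: Shioda1982PicardFermat, table p. 727] -/
theorem not_isExceptionalQuadruple_oneHundredTwentyTwo (s : Multiset (ZMod 122)) : ¬ IsExceptionalQuadruple 122 s := by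
  intro hs
  obtain ⟨r, hr, -⟩ := exists_mem_reps_of_isExceptionalQuadruple completeAt_oneHundredTwentyTwo hs
  simp [reps, tabelleOne] at hr

/-- **No exceptional quadruple ("Ausnahmequadrupel") at the level `123`** (`tabelleOne 123 = []`).
[cite: MeyerNeutsch1981Fermatquadrupel, Tabelle 1 p. 54 (no row 123)] [cite: Shioda1982PicardFermat, table p. 727] -/
theorem not_isExceptionalQuadruple_oneHundredTwentyThree (s : Multiset (ZMod 123)) : ¬ IsExceptionalQuadruple 123 s := by
  intro hs
  obtain ⟨r, hr, -⟩ := exists_mem_reps_of_isExceptionalQuadruple completeAt_oneHundredTwentyThree hs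
  simp [reps, tabelleOne] at hr

/-- **No exceptional quadruple ("Ausnahmequadrupel") at the level `124`** (`tabelleOne 124 = []`).
[cite: MeyerNeutsch1981Fermatquadrupel, Tabelle 1 p. 54 (no row 124)] [cite: Shioda1982PicardFermat, table p. 727] -/
theorem not_isExceptionalQuadruple_oneHundredTwentyFour (s : Multiset (ZMod 124)) : ¬ IsExceptionalQuadruple 124 s := by
  intro hs
  obtain ⟨r, hr, -⟩ := exists_mem_reps_of_isExceptionalQuadruple completeAt_oneHundredTwentyFour hs
  simp [reps, tabelleOne] at hr

/-- **No exceptional quadruple ("Ausnahmequadrupel") at the level `125`** (`tabelleOne 125 = []`).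
[cite: MeyerNeutsch1981Fermatquadrupel, Tabelle 1 p. 54 (no row 125)] [cite: Shioda1982PicardFermat, table p. 727] -/
theorem not_isExceptionalQuadruple_oneHundredTwentyFive (s : Multiset (ZMod 125)) : ¬ IsExceptionalQuadruple 125 s := by
  intro hs
  obtain ⟨r, hr, -⟩ := exists_mem_reps_of_isExceptionalQuadruple completeAt_oneHundredTwentyFive hs
  simp [reps, tabelleOne] at hr

/-- **No exceptional quadruple ("Ausnahmequadrupel") at the level `126`** (`tabelleOne 126 = []`).
[cite: MeyerNeutsch1981Fermatquadrupel, Tabelle 1 p. 54 (no row 126)] [cite: Shioda1982PicardFermat, table p. 727] -/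
theorem not_isExceptionalQuadruple_oneHundredTwentySix (s : Multiset (ZMod 126)) : ¬ IsExceptionalQuadruple 126 s := by
  intro hs
  obtain ⟨r, hr, -⟩ := exists_mem_reps_of_isExceptionalQuadruple completeAt_oneHundredTwentySix hs
  simp [reps, tabelleOne] at hr

/-- **No exceptional quadruple ("Ausnahmequadrupel") at the level `127`** (`tabelleOne 127 = []`).
[cite: MeyerNeutsch1981Fermatquadrupel, Tabelle 1 p. 54 (no row 127)] [cite: Shioda1982PicardFermat, table p. 727] -/
theorem not_isExceptionalQuadruple_oneHundredTwentySeven (s : Multiset (ZMod 127)) : ¬ IsExceptionalQuadruple 127 s := by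
  intro hs
  obtain ⟨r, hr, -⟩ := exists_mem_reps_of_isExceptionalQuadruple completeAt_oneHundredTwentySeven hs
  simp [reps, tabelleOne] at hr

/-- **No exceptional quadruple ("Ausnahmequadrupel") at the level `128`** (`tabelleOne 128 = []`).
[cite: MeyerNeutsch1981Fermatquadrupel, Tabelle 1 p. 54 (no row 128)] [cite: Shioda1982PicardFermat, table p. 727] -/
theorem not_isExceptionalQuadruple_oneHundredTwentyEight (s : Multiset (ZMod 128)) : ¬ IsExceptionalQuadruple 128 s := by
  intro hs
  obtain ⟨r, hr, -⟩ := exists_mem_reps_of_isExceptionalQuadruple completeAt_oneHundredTwentyEight hs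
  simp [reps, tabelleOne] at hr

end Literature.AlgebraicGeometry.Shioda1982
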